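import Literature.Computability.QuantumComplexity.AWPPAmplification
import Literature.Computability.QuantumComplexity.BQPSubsetAWPP
import Literature.Computability.Complexity.PRelAdaptiveForm
import Literature.Computability.Complexity.ToranCounting
import HarnessLib

/-!
# `AWPP` is low for `PP` (Li 1993; Fortnow–Rogers 1999, Thm. 3.3) and `PP^{BQP} = PP` (Cor. 3.4)

Final step of the proof of the named fact
`Literature.Computability.QuantumComplexity.iUnion_PPRel_BQP_eq_PP` (`CountingSimulation.lean`,
**quantum-advantage.S17**: `(⋃ L ∈ BQP, PP^L) = PP`), discharged here as
`iUnion_PPRel_BQP_eq_PP_holds` by Fortnow–Rogers' printed assembly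
`iUnion_PPRel_BQP_eq_PP_of` (`CountingSimulationProofs.lean`: Cor. 3.4 from Thm. 3.1 `BQP ⊆ AWPP`,
the tree's `BQP_subset_AWPP_holds` of `BQPSubsetAWPP.lean`, and Thm. 3.3) applied to the theorem
of this file, **`AWPP_low_PP : ∀ L ∈ AWPP, PP^L ⊆ PP`** (Fortnow–Rogers 1999, Thm. 3.3, crediting
L. Li's 1993 thesis; published proof: Fenner 2003).

Fortnow–Rogers' proof sketch (arXiv:cs/9811023, p. 5): "Let `M^A` be a `PP^A` machine, `A ∈ AWPP`
… simulate `M`, answering each oracle query `y` by guessing the answer and multiplying in the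
amplified `GapP` function `N(y, 1^{|x|})` (resp. `1 - N`) … by Thm. 2.2 the result is a `GapP`
function, and since the errors, summed over fewer than `2^{q/2}` paths, cannot flip the sign of the
gap, it witnesses `L(M^A) ∈ PP`." The formalisation, in the tree's transcript model:

* `PP^L = C'·(P^L)` (`PPRel`, `pMajority`), and a `P^L` predicate `W` is a bounded adaptive
  reduction `W = adLang Q q D L` (`AdQuery.exists_eq_adLang_of_mem_PRel'`, Ladner–Lynch–Selman
  normal form): `T = q(|w|)` queries `z_j = Q⟨w, answers so far⟩`, verdict `⟨w, answers⟩ ∈ D`.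
* With the amplifier `G` of `AWPPAmp.exists_amplifier` (error `2^{-K}`, `K = T + |w| + 3`, common
  denominator `2^{e|w|}` for all queries of length `≤ r(|w|)`), the guessed-transcript sum
  `h(w) = Σ_{as ∈ {0,1}^T} [⟨w, as⟩ ∈ D] · Π_{j<T} τ_j(as)`, `τ_j(as) = G⟨z_j(as), w⟩` if `as_j = 1`
  and `2^{e|w|} - G⟨z_j(as), w⟩` otherwise, is in `GapP` (`GapPClosure.prod_mem_GapP`,
  `sum_mem_GapP`, the bit test `exists_bitSel`, queries recomputed by `Q ∈ FP` from `as ↾ j`).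
* **`replay_estimate`** (the error analysis, machine-free): along the true answers every factor
  is at least `(1 - 2^{-K}) 2^e`, so their product is at least `(1 - T 2^{-K}) 2^{eT}` (Bernoulli,
  `bernoulli_sub_one`); every other transcript first deviates at some query which is then the TRUE
  query with the wrong answer (`exists_first_diff`), so its weight is at most `2^{-K} 2^{eT}`; hence
  `|2^{|w|+3} h(w) - [w ∈ W] 2^{|w|+3} 2^{eT}| ≤ 2^{eT}`.
* Summing over the `2^{m|x|}` coin strings `y` (`w = ⟨x, y⟩`, `GapPClosure.sum_mem_GapP`) gives
  `H ∈ GapP` with `8|H(x) - 2^{B}·#{y | ⟨x,y⟩ ∈ W}| ≤ 2^{B}`, so `x ∈ A ↔ 0 < 4H(x) - 2^{B+M+1} - 2^B`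
  and `A ∈ PP` by the `GapP` form of `PP` (`PPGapP.mem_PP_of_gapP`, Fenner–Fortnow–Kurtz 1994,
  Prop. 4.2).

## References

* L. Fortnow, J. Rogers, *Complexity limitations on quantum computation*, J. Comput. System Sci.
  59 (1999) 240–252 = arXiv:cs/9811023 (arXiv numbering): Thm. 3.3 ("(Li) `AWPP` is low for `PP`")
  with its proof sketch, Cor. 3.4 (`BQP` is low for `PP`), Thm. 3.1, Thm. 2.2, Def. 2.5.
* L. Li, *On the counting functions*, PhD thesis, University of Chicago, 1993 (Tech. Report
  TR-93-12), §5.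
* S. Fenner, *PP-lowness and a simple definition of AWPP*, Theory Comput. Syst. 36 (2003) 199–212.
* S. Fenner, L. Fortnow, S. Kurtz, L. Li, *An oracle builder's toolkit*, Inform. and Comput. 182
  (2003) 95–136, §6.1 (remark after Def. 6.1: `AWPP` is low for `PP`).
* R. E. Ladner, N. A. Lynch, A. L. Selman, *A comparison of polynomial time reducibilities*,
  Theoret. Comput. Sci. 1 (1975) 103–123, §2.
-/

noncomputable section

open Computability Literature.Computability.Complexity Literature.Computability.Cryptography

namespace Literature.Computability.QuantumComplexity

open Polynomial Finset Literature.Computability.Complexity.TTClosure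
  Literature.Computability.Complexity.PPSharpP Literature.Computability.Complexity.PPGapP
  Literature.Computability.Complexity.Brick Literature.Computability.Complexity.Plumb
  Literature.Computability.Complexity.AdQuery AWPPPP GapPRing GapPClosure AWPPAmp

open scoped Classical

namespace AWPPLow

/-! ### Machine-free lemmas -/

/-- **First deviation**: two distinct bit strings of the same length agree on a longest common
prefix and then differ. [folklore] -/
theorem exists_first_diff : ∀ (l₁ l₂ : List Bool), l₁.length = l₂.length → l₁ ≠ l₂ →
    ∃ i < l₁.length, l₁.take i = l₂.take i ∧ l₁.getD i false ≠ l₂.getD i false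
  | [], [], _, hne => absurd rfl hne
  | [], _ :: _, hlen, _ => absurd hlen (by simp)
  | _ :: _, [], hlen, _ => absurd hlen (by simp)
  | b₁ :: l₁, b₂ :: l₂, hlen, hne => by
    by_cases hb : b₁ = b₂
    · subst hb
      have hne' : l₁ ≠ l₂ := fun h => hne (by rw [h])
      obtain ⟨i, hi, htake, hget⟩ := exists_first_diff l₁ l₂ (by simpa using hlen) hne'
      exact ⟨i + 1, by simp; omega, by simp [htake], by simpa using hget⟩
    · exact ⟨0, by simp, by simp, by simpa using hb⟩

/-- **Bernoulli's inequality, homogeneous integer form**: `X^{T+1} - (T+1) X^T ≤ (X-1)^{T+1}` for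
`X ≥ 1`. [folklore] -/
theorem bernoulli_sub_one {X : ℤ} (hX : 1 ≤ X) : ∀ T : ℕ, X ^ (T + 1) - ((T + 1 : ℕ) : ℤ) * X ^ T ≤ (X - 1) ^ (T + 1)
  | 0 => by simp
  | T + 1 => by
    have ih := bernoulli_sub_one hX T
    have hX0 : 0 ≤ X - 1 := by linarith
    have h1 : (X ^ (T + 1) - ((T + 1 : ℕ) : ℤ) * X ^ T) * (X - 1) ≤ (X - 1) ^ (T + 1) * (X - 1) :=
      mul_le_mul_of_nonneg_right ih hX0
    have hdiff : (X ^ (T + 1) - ((T + 1 : ℕ) : ℤ) * X ^ T) * (X - 1) -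
        (X ^ (T + 1 + 1) - ((T + 1 + 1 : ℕ) : ℤ) * X ^ (T + 1)) = ((T : ℤ) + 1) * X ^ T := by
      push_cast; ring
    have hnn : (0 : ℤ) ≤ ((T : ℤ) + 1) * X ^ T := by
      have : (0 : ℤ) ≤ X ^ T := pow_nonneg (by linarith) T
      positivity
    calc X ^ (T + 1 + 1) - ((T + 1 + 1 : ℕ) : ℤ) * X ^ (T + 1)
        ≤ (X ^ (T + 1) - ((T + 1 : ℕ) : ℤ) * X ^ T) * (X - 1) := by linarith
      _ ≤ (X - 1) ^ (T + 1) * (X - 1) := h1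
      _ = (X - 1) ^ (T + 1 + 1) := (pow_succ (X - 1) (T + 1)).symm

/-- **The error analysis of the guessed-transcript sum** (machine-free). Transcripts `as ∈ {0,1}^T`
carry weights `Π_{j<T} τ(as, j)` with `0 ≤ τ ≤ E`; along the true transcript `ast` every factor
satisfies `(2^K - 1) E ≤ 2^K τ`, and a transcript that first deviates from `ast` at position `i`
has `2^K τ(as, i) ≤ E` there. Then the accepted weight `h = Σ_{as accepted} Π_j τ(as, j)` satisfies
`2^K h ≤ [ast accepted] 2^K E^T + 2^T E^T` and `[ast accepted] (2^K - T) E^T ≤ 2^K h` — "the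
errors, summed over all paths, do not change the sign of the gap".
[cite: FortnowRogers1999JCSS, Thm. 3.3 (proof sketch, arXiv numbering)] -/
theorem replay_estimate (T K : ℕ) (E : ℤ) (hE : 0 ≤ E) (τ : List Bool → ℕ → ℤ) (acc : List Bool → Prop)
    (ast : List Bool) (hast : ast.length = T)
    (h01 : ∀ (as : List Bool) (j : ℕ), j < T → 0 ≤ τ as j ∧ τ as j ≤ E)
    (hgood : ∀ j < T, ((2 : ℤ) ^ K - 1) * E ≤ (2 : ℤ) ^ K * τ ast j)
    (hbad : ∀ as : List Bool, as.length = T → ∀ i < T, as.take i = ast.take i →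
      as.getD i false ≠ ast.getD i false → (2 : ℤ) ^ K * τ as i ≤ E) :
    (2 : ℤ) ^ K * (∑ as : List.Vector Bool T, if acc as.toList then ∏ j ∈ range T, τ as.toList j else 0) ≤
        (if acc ast then (2 : ℤ) ^ K * E ^ T else 0) + (2 : ℤ) ^ T * E ^ T ∧
      (if acc ast then ((2 : ℤ) ^ K - T) * E ^ T else 0) ≤
        (2 : ℤ) ^ K * (∑ as : List.Vector Bool T, if acc as.toList then ∏ j ∈ range T, τ as.toList j else 0) := by
  set f : List.Vector Bool T → ℤ := fun as => if acc as.toList then ∏ j ∈ range T, τ as.toList j else 0 with hf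
  set astV : List.Vector Bool T := ⟨ast, hast⟩ with hastV
  have hsplit := Finset.add_sum_erase (univ : Finset (List.Vector Bool T)) f (mem_univ astV)
  have h2K : (0 : ℤ) ≤ (2 : ℤ) ^ K := pow_nonneg (by norm_num) K
  -- products lie in `[0, E^T]`
  have hprod_nonneg : ∀ as : List Bool, 0 ≤ ∏ j ∈ range T, τ as j := fun as =>
    Finset.prod_nonneg fun j hj => (h01 as j (mem_range.1 hj)).1
  have hprod_le : ∀ as : List Bool, ∏ j ∈ range T, τ as j ≤ E ^ T := fun as => by
    calc ∏ j ∈ range T, τ as j ≤ ∏ _j ∈ range T, E :=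
          Finset.prod_le_prod (fun j hj => (h01 as j (mem_range.1 hj)).1) (fun j hj => (h01 as j (mem_range.1 hj)).2)
      _ = E ^ T := by rw [prod_const, card_range]
  have hf_nonneg : ∀ as, 0 ≤ f as := fun as => by
    simp only [hf]
    split_ifs
    · exact hprod_nonneg _
    · exact le_rfl
  -- a wrong transcript is light
  have hbadV : ∀ as ∈ (univ : Finset (List.Vector Bool T)).erase astV, (2 : ℤ) ^ K * f as ≤ E ^ T := by
    intro as has
    have hne : as.toList ≠ ast := fun h => (mem_erase.1 has).1 (List.Vector.eq as astV h)
    obtain ⟨i, hi, htake, hget⟩ := exists_first_diff as.toList ast (by rw [as.toList_length, hast]) hne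
    rw [as.toList_length] at hi
    simp only [hf]
    split_ifs with hacc
    · rw [← Finset.mul_prod_erase (range T) (τ as.toList) (mem_range.2 hi), ← mul_assoc]
      have hrest : ∏ j ∈ (range T).erase i, τ as.toList j ≤ E ^ (T - 1) := by
        calc ∏ j ∈ (range T).erase i, τ as.toList j ≤ ∏ _j ∈ (range T).erase i, E :=
              Finset.prod_le_prod (fun j hj => (h01 _ j (mem_range.1 (mem_of_mem_erase hj))).1)
                (fun j hj => (h01 _ j (mem_range.1 (mem_of_mem_erase hj))).2)
          _ = E ^ (T - 1) := by rw [prod_const, card_erase_of_mem (mem_range.2 hi), card_range]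
      have hrest0 : 0 ≤ ∏ j ∈ (range T).erase i, τ as.toList j :=
        Finset.prod_nonneg fun j hj => (h01 _ j (mem_range.1 (mem_of_mem_erase hj))).1
      have hi' := hbad as.toList (by rw [as.toList_length]) i hi htake hget
      calc (2 : ℤ) ^ K * τ as.toList i * ∏ j ∈ (range T).erase i, τ as.toList j
          ≤ E * E ^ (T - 1) := mul_le_mul hi' hrest hrest0 hE
        _ = E ^ T := by rw [← pow_succ']; congr 1; omega
    · rw [mul_zero]
      exact pow_nonneg hE T
  have hcard : (((univ : Finset (List.Vector Bool T)).erase astV).card : ℤ) ≤ (2 : ℤ) ^ T := by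
    have h : ((univ : Finset (List.Vector Bool T)).erase astV).card ≤ 2 ^ T := by
      rw [card_erase_of_mem (mem_univ _), card_univ, card_vector, Fintype.card_bool]
      exact Nat.sub_le _ _
    exact_mod_cast h
  have hsum_bad : (2 : ℤ) ^ K * ∑ as ∈ (univ : Finset (List.Vector Bool T)).erase astV, f as ≤ (2 : ℤ) ^ T * E ^ T := by
    rw [Finset.mul_sum]
    calc ∑ as ∈ (univ : Finset (List.Vector Bool T)).erase astV, (2 : ℤ) ^ K * f as
        ≤ ((univ : Finset (List.Vector Bool T)).erase astV).card • (E ^ T) := Finset.sum_le_card_nsmul _ _ _ hbadV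
      _ = (((univ : Finset (List.Vector Bool T)).erase astV).card : ℤ) * E ^ T := by rw [nsmul_eq_mul]
      _ ≤ (2 : ℤ) ^ T * E ^ T := mul_le_mul_of_nonneg_right hcard (pow_nonneg hE T)
  have hsum_bad0 : 0 ≤ ∑ as ∈ (univ : Finset (List.Vector Bool T)).erase astV, f as :=
    Finset.sum_nonneg fun as _ => hf_nonneg as
  -- the true transcript is heavy
  have hfast : f astV = if acc ast then ∏ j ∈ range T, τ ast j else 0 := rfl
  have hgoodprod : ((2 : ℤ) ^ K - T) * E ^ T ≤ (2 : ℤ) ^ K * ∏ j ∈ range T, τ ast j := by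
    have h2K1 : (0 : ℤ) ≤ (2 : ℤ) ^ K - 1 := by
      have : (1 : ℤ) ≤ (2 : ℤ) ^ K := one_le_pow₀ (by norm_num)
      linarith
    have h1 : (((2 : ℤ) ^ K - 1) * E) ^ T ≤ ((2 : ℤ) ^ K) ^ T * ∏ j ∈ range T, τ ast j := by
      calc (((2 : ℤ) ^ K - 1) * E) ^ T = ∏ _j ∈ range T, (((2 : ℤ) ^ K - 1) * E) := by rw [prod_const, card_range]
        _ ≤ ∏ j ∈ range T, ((2 : ℤ) ^ K * τ ast j) :=
            Finset.prod_le_prod (fun j _ => mul_nonneg h2K1 hE) (fun j hj => hgood j (mem_range.1 hj))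
        _ = ((2 : ℤ) ^ K) ^ T * ∏ j ∈ range T, τ ast j := by rw [prod_mul_distrib, prod_const, card_range]
    rcases Nat.eq_zero_or_pos T with hT0 | hTpos
    · subst hT0
      simp
    · obtain ⟨T', rfl⟩ : ∃ T', T = T' + 1 := ⟨T - 1, by omega⟩
      have hb := bernoulli_sub_one (X := (2 : ℤ) ^ K) (one_le_pow₀ (by norm_num)) T'
      have hXpos : (0 : ℤ) < ((2 : ℤ) ^ K) ^ T' := by positivity
      refine le_of_mul_le_mul_left ?_ hXpos
      calc ((2 : ℤ) ^ K) ^ T' * (((2 : ℤ) ^ K - ((T' + 1 : ℕ) : ℤ)) * E ^ (T' + 1))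
          = (((2 : ℤ) ^ K) ^ (T' + 1) - ((T' + 1 : ℕ) : ℤ) * ((2 : ℤ) ^ K) ^ T') * E ^ (T' + 1) := by ring
        _ ≤ ((2 : ℤ) ^ K - 1) ^ (T' + 1) * E ^ (T' + 1) := mul_le_mul_of_nonneg_right hb (pow_nonneg hE _)
        _ = (((2 : ℤ) ^ K - 1) * E) ^ (T' + 1) := by rw [mul_pow]
        _ ≤ ((2 : ℤ) ^ K) ^ (T' + 1) * ∏ j ∈ range (T' + 1), τ ast j := h1
        _ = ((2 : ℤ) ^ K) ^ T' * ((2 : ℤ) ^ K * ∏ j ∈ range (T' + 1), τ ast j) := by ring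
  -- assembly
  have hbad' : 0 ≤ (2 : ℤ) ^ K * ∑ as ∈ (univ : Finset (List.Vector Bool T)).erase astV, f as :=
    mul_nonneg h2K hsum_bad0
  constructor
  · rw [← hsplit, mul_add]
    have hfirst : (2 : ℤ) ^ K * f astV ≤ if acc ast then (2 : ℤ) ^ K * E ^ T else 0 := by
      rw [hfast]
      split_ifs with hacc
      · exact mul_le_mul_of_nonneg_left (hprod_le ast) h2K
      · simp
    linarith [hfirst, hsum_bad]
  · rw [← hsplit, mul_add]
    have hfirst : (if acc ast then ((2 : ℤ) ^ K - T) * E ^ T else 0) ≤ (2 : ℤ) ^ K * f astV := by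
      rw [hfast]
      split_ifs with hacc
      · exact hgoodprod
      · simp
    linarith [hfirst, hbad']

/-! ### Li's theorem -/

/-- Sums of an indicator-weighted constant. [folklore] -/
theorem sum_ite_const_zero {ι : Type*} (s : Finset ι) (p : ι → Prop) (c : ℤ) :
    ∑ i ∈ s, (if p i then c else 0) = c * ∑ i ∈ s, (if p i then (1 : ℤ) else 0) := by
  rw [Finset.mul_sum]
  exact Finset.sum_congr rfl fun i _ => by split_ifs <;> simp
set_option maxHeartbeats 400000 in -- buildfix (bf3-g26): 160k/180k FAIL, 200k PASS at accept time; line-neutral budget line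
/-- **`AWPP` is low for `PP`** (Li 1993; Fortnow–Rogers 1999, Thm. 3.3; Fenner 2003): for every
`L ∈ AWPP`, `PP^L ⊆ PP`. Proof as in the module docstring: a `PP^L` language is a majority vote
over a `P^L` predicate `W = adLang Q q D L` (Ladner–Lynch–Selman normal form); the guessed-transcript
sum `h(w) = Σ_{as} [⟨w, as⟩ ∈ D] Π_j τ_j(as)` with the amplified `AWPP` weights
(`AWPPAmp.exists_amplifier`) is a `GapP` function (`GapPClosure.prod_mem_GapP`, `sum_mem_GapP`)
within `2^{-|w|-3}·2^{eT}` of `[w ∈ W]·2^{eT}` (`replay_estimate`), and summing over the coins gives a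
`GapP` threshold representation of the vote (`PPGapP.mem_PP_of_gapP`).
[cite: FortnowRogers1999JCSS, Thm. 3.3 (arXiv numbering)] -/
theorem AWPP_low_PP : ∀ L ∈ AWPP, PPRel (Oracle.ofLanguage L) ⊆ PP := by
  intro L hL A hA
  obtain ⟨W, hW, m, hAm⟩ := hA
  obtain ⟨Q, hQ, s, hs, D, hD, q, rfl⟩ := exists_eq_adLang_of_mem_PRel' hW
  -- polynomials: query-length bound `r`, error exponent `kp = q + X + 3`
  obtain ⟨r, hr⟩ : ∃ r : Polynomial ℕ, r = s.comp (2 * X + 2 + q) := ⟨_, rfl⟩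
  obtain ⟨kp, hkp⟩ : ∃ kp : Polynomial ℕ, kp = q + X + 3 := ⟨_, rfl⟩
  have eval_r : ∀ n, r.eval n = s.eval (2 * n + 2 + q.eval n) := fun n => by simp [hr]
  have eval_kp : ∀ n, kp.eval n = q.eval n + n + 3 := fun n => by simp [hkp]
  obtain ⟨G, hG, e, hGe⟩ := exists_amplifier hL kp r
  obtain ⟨B, hBP, hB⟩ := exists_bitSel
  -- reindexing a sum over `{0,1}^a` along `a = b` (the summand reads the underlying list)
  have sum_vector_cast : ∀ {a b : ℕ}, a = b → ∀ F : List Bool → ℤ,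
      ∑ v : List.Vector Bool a, F v.toList = ∑ v : List.Vector Bool b, F v.toList := by
    intro a b hab F
    subst hab
    rfl
  -- the weight of round `j` along the guessed answers `as`
  obtain ⟨τ, hτ⟩ : ∃ τ : List Bool → List Bool → ℕ → ℤ, τ = fun w as j =>
      if as.getD j false = true then G (boolPair (Q (boolPair w (as.take j))) w)
      else (2 : ℤ) ^ e.eval w.length - G (boolPair (Q (boolPair w (as.take j))) w) := ⟨_, rfl⟩
  have hτ_true : ∀ (w as : List Bool) (j : ℕ), as.getD j false = true →
      τ w as j = G (boolPair (Q (boolPair w (as.take j))) w) := fun w as j hb => by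
    rw [hτ]; exact if_pos hb
  have hτ_false : ∀ (w as : List Bool) (j : ℕ), as.getD j false = false →
      τ w as j = (2 : ℤ) ^ e.eval w.length - G (boolPair (Q (boolPair w (as.take j))) w) := fun w as j hb => by
    rw [hτ]; exact if_neg (by rw [hb]; exact Bool.false_ne_true)
  -- `FP` plumbing on `U = ⟨⟨w, as⟩, 1ʲ⟩`: `wf U = w`, `zf U = ⟨Q⟨w, as ↾ j⟩, w⟩`
  obtain ⟨wf, hwf⟩ : ∃ f : List Bool → List Bool, f = fstF ∘ fstF := ⟨_, rfl⟩
  have hwfFP : wf ∈ FP := hwf ▸ comp_mem_FP fstF_mem_FP fstF_mem_FP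
  obtain ⟨zf, hzf⟩ : ∃ f : List Bool → List Bool,
      f = fanoutFn (Q ∘ fanoutFn wf (takeFn ∘ fanoutFn sndF (sndF ∘ fstF))) wf := ⟨_, rfl⟩
  have hzfFP : zf ∈ FP := hzf ▸ fanoutFn_mem_FP (comp_mem_FP hQ (fanoutFn_mem_FP hwfFP
    (comp_mem_FP takeFn_mem_FP (fanoutFn_mem_FP sndF_mem_FP (comp_mem_FP sndF_mem_FP fstF_mem_FP))))) hwfFP
  have hwf_apply : ∀ w as u : List Bool, wf (boolPair (boolPair w as) u) = w := by
    intro w as u; simp [hwf]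
  have hzf_apply : ∀ (w as : List Bool) (j : ℕ),
      zf (boolPair (boolPair w as) (ones j)) = boolPair (Q (boolPair w (as.take j))) w := by
    intro w as j; simp [hzf, hwf, fanoutFn_apply, takeFn_boolPair]
  obtain ⟨cT, hcT⟩ : ∃ f : List Bool → ℤ,
      f = fun U => if U ∈ B then G (zf U) else (2 : ℤ) ^ e.eval (wf U).length - G (zf U) := ⟨_, rfl⟩
  have hcT_mem : cT ∈ GapP := hcT ▸ piecewise_mem_GapP (comp_mem_GapP hG hzfFP)
    (sub_mem_GapP (comp_mem_GapP (two_pow_mem_GapP e) hwfFP) (comp_mem_GapP hG hzfFP)) hBP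
  have hcT_apply : ∀ (w as : List Bool) (j : ℕ), cT (boolPair (boolPair w as) (ones j)) = τ w as j := by
    intro w as j
    have hj : (ones j).length = j := List.length_replicate
    rw [hcT]
    show (if boolPair (boolPair w as) (ones j) ∈ B then G (zf (boolPair (boolPair w as) (ones j)))
      else (2 : ℤ) ^ e.eval (wf (boolPair (boolPair w as) (ones j))).length -
        G (zf (boolPair (boolPair w as) (ones j)))) = _
    rw [hzf_apply, hwf_apply]
    by_cases hbit : as.getD j false = true
    · rw [if_pos ((hB _ _ _).2 (hj.symm ▸ hbit)), hτ_true w as j hbit]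
    · rw [if_neg (fun h => hbit (hj ▸ (hB _ _ _).1 h)), hτ_false w as j (by simpa using hbit)]
  -- the product over the `q(|w|)` rounds, `y = ⟨w, as⟩`
  obtain ⟨tT, htT⟩ : ∃ f : List Bool → List Bool, f = polyFn q ∘ fstF := ⟨_, rfl⟩
  have htTFP : tT ∈ FP := htT ▸ comp_mem_FP (polyFn_mem_FP q) fstF_mem_FP
  have htT_apply : ∀ w as : List Bool, (tT (boolPair w as)).length = q.eval w.length := by
    intro w as; simp [htT]
  obtain ⟨Pr, hPr⟩ : ∃ f : List Bool → ℤ, f = fun y => ∏ j ∈ range (tT y).length, cT (boolPair y (ones j)) :=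
    ⟨_, rfl⟩
  have hPr_mem : Pr ∈ GapP := hPr ▸ prod_mem_GapP hcT_mem htTFP
  have hPr_apply : ∀ w as : List Bool, Pr (boolPair w as) = ∏ j ∈ range (q.eval w.length), τ w as j := by
    intro w as
    rw [hPr]
    show ∏ j ∈ range (tT (boolPair w as)).length, cT (boolPair (boolPair w as) (ones j)) = _
    rw [htT_apply]
    exact Finset.prod_congr rfl fun j _ => hcT_apply w as j
  -- the guessed-transcript sum `h(w)`
  obtain ⟨h, hh⟩ : ∃ f : List Bool → ℤ, f = fun w => ∑ as : List.Vector Bool (polyFn q w).length,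
      (if boolPair w as.toList ∈ D then Pr (boolPair w as.toList) else 0) := ⟨_, rfl⟩
  have hh_mem : h ∈ GapP := hh ▸ sum_mem_GapP (ite_mem_GapP hPr_mem hD) (polyFn_mem_FP q)
  have hh_apply : ∀ w : List Bool, h w = ∑ as : List.Vector Bool (q.eval w.length),
      (if boolPair w as.toList ∈ D then ∏ j ∈ range (q.eval w.length), τ w as.toList j else 0) := by
    intro w
    rw [hh]
    show ∑ as : List.Vector Bool (polyFn q w).length,
      (if boolPair w as.toList ∈ D then Pr (boolPair w as.toList) else 0) = _
    rw [sum_vector_cast (show (polyFn q w).length = q.eval w.length by simp)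
      (fun l => if boolPair w l ∈ D then Pr (boolPair w l) else 0)]
    exact Finset.sum_congr rfl fun as _ => by
      show (if boolPair w as.toList ∈ D then Pr (boolPair w as.toList) else 0) = _
      rw [hPr_apply]
  -- the outer sum over the coins `y`, `H(x) = Σ_y h⟨x, y⟩`
  obtain ⟨H, hH⟩ : ∃ f : List Bool → ℤ,
      f = fun x => ∑ y : List.Vector Bool (polyFn m x).length, h (boolPair x y.toList) := ⟨_, rfl⟩
  have hH_mem : H ∈ GapP := hH ▸ sum_mem_GapP hh_mem (polyFn_mem_FP m)
  have hH_apply : ∀ x : List Bool, H x = ∑ y : List.Vector Bool (m.eval x.length), h (boolPair x y.toList) := by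
    intro x
    rw [hH]
    exact sum_vector_cast (show (polyFn m x).length = m.eval x.length by simp) (fun l => h (boolPair x l))
  -- the threshold exponents: `bp = eT` and `ap = eT + M + 1` at `n = 2|x| + 2 + M`
  obtain ⟨bp, hbp⟩ : ∃ bp : Polynomial ℕ, bp = (e * q).comp (2 * X + 2 + m) := ⟨_, rfl⟩
  obtain ⟨ap, hap⟩ : ∃ ap : Polynomial ℕ, ap = bp + m + 1 := ⟨_, rfl⟩
  have eval_bp : ∀ n, bp.eval n = e.eval (2 * n + 2 + m.eval n) * q.eval (2 * n + 2 + m.eval n) := fun n => by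
    simp [hbp]
  have eval_ap : ∀ n, ap.eval n = bp.eval n + m.eval n + 1 := fun n => by simp [hap]
  have hF_mem : (fun x => ((4 : ℕ) : ℤ) * H x - (2 : ℤ) ^ ap.eval x.length - (2 : ℤ) ^ bp.eval x.length) ∈ GapP :=
    sub_mem_GapP (sub_mem_GapP (nsmul_mem_GapP 4 hH_mem) (two_pow_mem_GapP ap)) (two_pow_mem_GapP bp)
  refine mem_PP_of_gapP hF_mem fun x => ?_
  -- ### the estimate at `x`
  obtain ⟨M, hM⟩ : ∃ M : ℕ, M = m.eval x.length := ⟨_, rfl⟩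
  obtain ⟨n, hn⟩ : ∃ n : ℕ, n = 2 * x.length + 2 + M := ⟨_, rfl⟩
  obtain ⟨T, hT⟩ : ∃ T : ℕ, T = q.eval n := ⟨_, rfl⟩
  obtain ⟨Ee, hEe⟩ : ∃ Ee : ℕ, Ee = e.eval n := ⟨_, rfl⟩
  obtain ⟨K, hK⟩ : ∃ K : ℕ, K = kp.eval n := ⟨_, rfl⟩
  have hKT : K = T + n + 3 := by rw [hK, eval_kp, hT]
  have hMn : M ≤ n := by omega
  -- ## the per-`w` estimate, `|w| = n`
  have hw_est : ∀ w : List Bool, w.length = n →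
      (2 : ℤ) ^ (n + 3) * h w ≤
          (if w ∈ adLang Q q D L then (2 : ℤ) ^ (n + 3) * (2 : ℤ) ^ (Ee * T) else 0) + (2 : ℤ) ^ (Ee * T) ∧
        (if w ∈ adLang Q q D L then (2 : ℤ) ^ (n + 3) * (2 : ℤ) ^ (Ee * T) else 0) ≤
          (2 : ℤ) ^ (n + 3) * h w + (2 : ℤ) ^ (Ee * T) := by
    intro w hwn
    -- the true answers
    obtain ⟨ast, hast⟩ : ∃ ast : List Bool, ast = adBits Q L w T := ⟨_, rfl⟩
    have hast_len : ast.length = T := by rw [hast, length_adBits]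
    have hbits : ∀ i < T, ast.getD i false = L.boolIndicator (Q (boolPair w (ast.take i))) := fun i hi => by
      rw [hast, ToranCH.adBits_getD hi, adBits_take L w hi.le]
    -- the queries are short
    have hqlen : ∀ (as : List Bool) (j : ℕ), j < T → (Q (boolPair w (as.take j))).length ≤ r.eval w.length := by
      intro as j hj
      refine (hs _).trans ?_
      rw [eval_r, hwn, ← hT]
      refine TM2Iter.eval_mono s ?_
      rw [length_boolPair, List.length_take, hwn]
      omega
    have hEw : e.eval w.length = Ee := by rw [hwn, hEe]
    have hKw : kp.eval w.length = K := by rw [hwn, hK]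
    -- the machine-free estimate
    have hrest := replay_estimate T K ((2 : ℤ) ^ Ee) (by positivity) (τ w) (fun as => boolPair w as ∈ D) ast hast_len
      (fun as j hj => by
        obtain ⟨⟨h0, h1⟩, -, -⟩ := hGe _ _ (hqlen as j hj)
        rw [hEw] at h1
        cases hb : as.getD j false
        · rw [hτ_false w as j hb, hEw]
          exact ⟨by linarith, by linarith⟩
        · rw [hτ_true w as j hb]
          exact ⟨h0, h1⟩)
      (fun j hj => by
        obtain ⟨⟨-, -⟩, hyes, hno⟩ := hGe _ _ (hqlen ast j hj)
        rw [hEw, hKw] at hyes hno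
        by_cases hz : Q (boolPair w (ast.take j)) ∈ L
        · rw [hτ_true w ast j (by rw [hbits j hj]; exact (Set.mem_iff_boolIndicator _ _).1 hz)]
          exact hyes hz
        · rw [hτ_false w ast j (by rw [hbits j hj]; exact (Set.notMem_iff_boolIndicator _ _).1 hz), hEw]
          have h' := hno hz
          linarith)
      (fun as _ i hi htake hget => by
        obtain ⟨⟨-, -⟩, hyes, hno⟩ := hGe _ _ (hqlen ast i hi)
        rw [hEw, hKw] at hyes hno
        by_cases hz : Q (boolPair w (ast.take i)) ∈ L
        · -- the true answer is `1`, so `as_i = 0`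
          have has : as.getD i false = false := by
            rw [hbits i hi, (Set.mem_iff_boolIndicator _ _).1 hz] at hget
            cases h' : as.getD i false
            · rfl
            · exact absurd h' hget
          rw [hτ_false w as i has, htake, hEw]
          have h' := hyes hz
          linarith
        · -- the true answer is `0`, so `as_i = 1`
          have has : as.getD i false = true := by
            rw [hbits i hi, (Set.notMem_iff_boolIndicator _ _).1 hz] at hget
            cases h' : as.getD i false
            · exact absurd h' hget
            · rfl
          rw [hτ_true w as i has, htake]
          exact hno hz)
    -- reading the estimate
    have hsum : (∑ as : List.Vector Bool T, if boolPair w as.toList ∈ D then ∏ j ∈ range T, τ w as.toList j else 0) = h w := by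
      rw [hh_apply w, hwn, ← hT]
    have hacc : boolPair w ast ∈ D ↔ w ∈ adLang Q q D L := by
      rw [mem_adLang_iff, hwn, ← hT, hast]
    rw [hsum, ← pow_mul] at hrest
    obtain ⟨hU, hLo⟩ := hrest
    have h2T : (0 : ℤ) < (2 : ℤ) ^ T := by positivity
    have hKpow : (2 : ℤ) ^ K = (2 : ℤ) ^ T * (2 : ℤ) ^ (n + 3) := by
      rw [hKT, show T + n + 3 = T + (n + 3) by omega, pow_add]
    have hTle : (T : ℤ) ≤ (2 : ℤ) ^ T := by exact_mod_cast (Nat.lt_two_pow_self).le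
    have hET : (0 : ℤ) ≤ (2 : ℤ) ^ (Ee * T) := by positivity
    by_cases hwW : w ∈ adLang Q q D L
    · rw [if_pos (hacc.2 hwW)] at hU hLo
      rw [if_pos hwW]
      constructor
      · refine le_of_mul_le_mul_left ?_ h2T
        calc (2 : ℤ) ^ T * ((2 : ℤ) ^ (n + 3) * h w) = (2 : ℤ) ^ K * h w := by rw [hKpow, mul_assoc]
          _ ≤ (2 : ℤ) ^ K * (2 : ℤ) ^ (Ee * T) + (2 : ℤ) ^ T * (2 : ℤ) ^ (Ee * T) := hU
          _ = (2 : ℤ) ^ T * ((2 : ℤ) ^ (n + 3) * (2 : ℤ) ^ (Ee * T) + (2 : ℤ) ^ (Ee * T)) := by rw [hKpow]; ring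
      · have h1 : (2 : ℤ) ^ T * (((2 : ℤ) ^ (n + 3) - 1) * (2 : ℤ) ^ (Ee * T)) ≤ (2 : ℤ) ^ T * ((2 : ℤ) ^ (n + 3) * h w) := by
          calc (2 : ℤ) ^ T * (((2 : ℤ) ^ (n + 3) - 1) * (2 : ℤ) ^ (Ee * T))
              = ((2 : ℤ) ^ K - (2 : ℤ) ^ T) * (2 : ℤ) ^ (Ee * T) := by rw [hKpow]; ring
            _ ≤ ((2 : ℤ) ^ K - T) * (2 : ℤ) ^ (Ee * T) := by
                refine mul_le_mul_of_nonneg_right ?_ hET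
                linarith
            _ ≤ (2 : ℤ) ^ K * h w := hLo
            _ = (2 : ℤ) ^ T * ((2 : ℤ) ^ (n + 3) * h w) := by rw [hKpow, mul_assoc]
        have h2 := le_of_mul_le_mul_left h1 h2T
        nlinarith [h2, hET]
    · rw [if_neg (fun h' => hwW (hacc.1 h'))] at hU hLo
      rw [if_neg hwW]
      constructor
      · refine le_of_mul_le_mul_left ?_ h2T
        calc (2 : ℤ) ^ T * ((2 : ℤ) ^ (n + 3) * h w) = (2 : ℤ) ^ K * h w := by rw [hKpow, mul_assoc]
          _ ≤ 0 + (2 : ℤ) ^ T * (2 : ℤ) ^ (Ee * T) := hU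
          _ = (2 : ℤ) ^ T * (0 + (2 : ℤ) ^ (Ee * T)) := by ring
      · have h0 : 0 ≤ h w := by
          have h2K : (0 : ℤ) < (2 : ℤ) ^ K := by positivity
          refine le_of_mul_le_mul_left ?_ h2K
          rw [mul_zero]; exact hLo
        positivity
  -- ## summing over the coins `y`
  set C : ℤ := ∑ y : List.Vector Bool M, (if boolPair x y.toList ∈ adLang Q q D L then (1 : ℤ) else 0) with hC
  have hlenw : ∀ y : List.Vector Bool M, (boolPair x y.toList).length = n := fun y => by
    rw [length_boolPair, y.toList_length, hn]
  have hHx : H x = ∑ y : List.Vector Bool M, h (boolPair x y.toList) := by rw [hH_apply, ← hM]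
  have hcardM : ((univ : Finset (List.Vector Bool M)).card : ℤ) = (2 : ℤ) ^ M := by
    simp [card_vector]
  have hUsum : (2 : ℤ) ^ (n + 3) * H x ≤ (2 : ℤ) ^ (n + 3) * (2 : ℤ) ^ (Ee * T) * C + (2 : ℤ) ^ M * (2 : ℤ) ^ (Ee * T) := by
    rw [hHx, Finset.mul_sum]
    calc ∑ y : List.Vector Bool M, (2 : ℤ) ^ (n + 3) * h (boolPair x y.toList)
        ≤ ∑ y : List.Vector Bool M, ((if boolPair x y.toList ∈ adLang Q q D L
              then (2 : ℤ) ^ (n + 3) * (2 : ℤ) ^ (Ee * T) else 0) + (2 : ℤ) ^ (Ee * T)) :=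
          Finset.sum_le_sum fun y _ => (hw_est _ (hlenw y)).1
      _ = (2 : ℤ) ^ (n + 3) * (2 : ℤ) ^ (Ee * T) * C + (2 : ℤ) ^ M * (2 : ℤ) ^ (Ee * T) := by
          rw [Finset.sum_add_distrib, sum_ite_const_zero, sum_const, nsmul_eq_mul, hcardM, hC]
  have hLsum : (2 : ℤ) ^ (n + 3) * (2 : ℤ) ^ (Ee * T) * C ≤ (2 : ℤ) ^ (n + 3) * H x + (2 : ℤ) ^ M * (2 : ℤ) ^ (Ee * T) := by
    have hsum2 : ∑ y : List.Vector Bool M, (if boolPair x y.toList ∈ adLang Q q D L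
          then (2 : ℤ) ^ (n + 3) * (2 : ℤ) ^ (Ee * T) else 0) ≤
        ∑ y : List.Vector Bool M, ((2 : ℤ) ^ (n + 3) * h (boolPair x y.toList) + (2 : ℤ) ^ (Ee * T)) :=
      Finset.sum_le_sum fun y _ => (hw_est _ (hlenw y)).2
    rw [sum_ite_const_zero, Finset.sum_add_distrib, sum_const, nsmul_eq_mul, hcardM, ← Finset.mul_sum, ← hHx] at hsum2
    exact hsum2
  -- divide by `2^n ≥ 2^M`
  have h2n : (0 : ℤ) < (2 : ℤ) ^ n := by positivity
  have hMn' : (2 : ℤ) ^ M ≤ (2 : ℤ) ^ n := pow_le_pow_right₀ (by norm_num) hMn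
  have hn3 : (2 : ℤ) ^ (n + 3) = (2 : ℤ) ^ n * 8 := by rw [pow_add]; norm_num
  have hET : (0 : ℤ) ≤ (2 : ℤ) ^ (Ee * T) := by positivity
  have hU8 : 8 * H x ≤ 8 * (2 : ℤ) ^ (Ee * T) * C + (2 : ℤ) ^ (Ee * T) := by
    refine le_of_mul_le_mul_left ?_ h2n
    have hMT : (2 : ℤ) ^ M * (2 : ℤ) ^ (Ee * T) ≤ (2 : ℤ) ^ n * (2 : ℤ) ^ (Ee * T) := mul_le_mul_of_nonneg_right hMn' hET
    calc (2 : ℤ) ^ n * (8 * H x) = (2 : ℤ) ^ (n + 3) * H x := by rw [hn3]; ring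
      _ ≤ (2 : ℤ) ^ (n + 3) * (2 : ℤ) ^ (Ee * T) * C + (2 : ℤ) ^ n * (2 : ℤ) ^ (Ee * T) := by linarith [hUsum, hMT]
      _ = (2 : ℤ) ^ n * (8 * (2 : ℤ) ^ (Ee * T) * C + (2 : ℤ) ^ (Ee * T)) := by rw [hn3]; ring
  have hL8 : 8 * (2 : ℤ) ^ (Ee * T) * C ≤ 8 * H x + (2 : ℤ) ^ (Ee * T) := by
    refine le_of_mul_le_mul_left ?_ h2n
    have hMT : (2 : ℤ) ^ M * (2 : ℤ) ^ (Ee * T) ≤ (2 : ℤ) ^ n * (2 : ℤ) ^ (Ee * T) := mul_le_mul_of_nonneg_right hMn' hET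
    calc (2 : ℤ) ^ n * (8 * (2 : ℤ) ^ (Ee * T) * C) = (2 : ℤ) ^ (n + 3) * (2 : ℤ) ^ (Ee * T) * C := by rw [hn3]; ring
      _ ≤ (2 : ℤ) ^ (n + 3) * H x + (2 : ℤ) ^ n * (2 : ℤ) ^ (Ee * T) := by linarith [hLsum, hMT]
      _ = (2 : ℤ) ^ n * (8 * H x + (2 : ℤ) ^ (Ee * T)) := by rw [hn3]; ring
  -- ## the count and the threshold
  have hcnt : (cnt M {y | boolPair x y ∈ adLang Q q D L} : ℤ) = C := by
    rw [ToranCH.cnt_eq_sum_indicator, Nat.cast_sum, hC]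
    refine Finset.sum_congr rfl fun y _ => ?_
    simp only [Set.mem_setOf_eq]
    split_ifs <;> simp
  have hbpx : bp.eval x.length = Ee * T := by rw [eval_bp, ← hM, ← hn, ← hEe, ← hT]
  have hapx : ap.eval x.length = Ee * T + M + 1 := by rw [eval_ap, hbpx, ← hM]
  have hpow : (2 : ℤ) ^ (Ee * T + M + 1) = (2 : ℤ) ^ (Ee * T) * (2 : ℤ) ^ M * 2 := by rw [pow_succ, pow_add]
  rw [hAm x, half_lt_uniformProb_iff, ← hM]
  show 2 ^ M < 2 * cnt M {y | boolPair x y ∈ adLang Q q D L} ↔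
    0 < ((4 : ℕ) : ℤ) * H x - (2 : ℤ) ^ ap.eval x.length - (2 : ℤ) ^ bp.eval x.length
  rw [hapx, hbpx, hpow]
  have h2M : ((2 ^ M : ℕ) : ℤ) = (2 : ℤ) ^ M := by norm_num
  have hEpos : (0 : ℤ) < (2 : ℤ) ^ (Ee * T) := by positivity
  constructor
  · intro hlt
    have hc : (2 : ℤ) ^ M + 1 ≤ 2 * C := by
      rw [← hcnt, ← h2M]; exact_mod_cast hlt
    have hEC : ((2 : ℤ) ^ M + 1) * (2 : ℤ) ^ (Ee * T) ≤ 2 * C * (2 : ℤ) ^ (Ee * T) := mul_le_mul_of_nonneg_right hc hET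
    push_cast
    nlinarith [hL8, hEC, hEpos]
  · intro hpos
    by_contra hge
    have hc : 2 * C ≤ (2 : ℤ) ^ M := by
      rw [← hcnt, ← h2M]; exact_mod_cast (Nat.not_lt.1 hge)
    have hEC : 2 * C * (2 : ℤ) ^ (Ee * T) ≤ (2 : ℤ) ^ M * (2 : ℤ) ^ (Ee * T) := mul_le_mul_of_nonneg_right hc hET
    push_cast at hpos
    nlinarith [hU8, hEC, hEpos, hpos]

end AWPPLow

/-! ### `PP^{BQP} = PP` -/

/-- **`PP^{BQP} = PP`** — discharge of the named fact `iUnion_PPRel_BQP_eq_PP`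
(**quantum-advantage.S17**, `CountingSimulation.lean`): Fortnow–Rogers' Cor. 3.4, assembled by
`iUnion_PPRel_BQP_eq_PP_of` (`CountingSimulationProofs.lean`) from Thm. 3.1 `BQP ⊆ AWPP` (the tree's
`BQP_subset_AWPP_holds`, `BQPSubsetAWPP.lean`) and Thm. 3.3 "`AWPP` is low for `PP`"
(`AWPPLow.AWPP_low_PP`). [cite: FortnowRogers1999JCSS, Cor. 3.4 (arXiv numbering)] -/
theorem iUnion_PPRel_BQP_eq_PP_holds : iUnion_PPRel_BQP_eq_PP :=
  iUnion_PPRel_BQP_eq_PP_of BQP_subset_AWPP_holds AWPPLow.AWPP_low_PP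

end Literature.Computability.QuantumComplexity

end
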